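import Literature.MathematicalPhysics.QuantumFieldTheory.Balaban1983to89.B8Thm4AtLandau138

/-!
# `Balaban1983to89.B8Thm4SupportLocal` — [Balaban1985RegularSpaces] THEOREM 4 (p. 88) on the concrete `ℤᵈ × 𝔸` carriers WITH THE GAUGE
# TRANSFORMATIONS CARRIED BY Ω₀: the induction driver re-run with the support invariant «u = 1 off Ω₀», its composition with
# Proposition 3 for gauge-fixed fields and the (1.42) clause (`pub-ymgap-dag-n04-b`), the Landau equation instantiated
# (`IsLandau138W`), and the uniqueness clause as an EQUALITY `u₁ = u₂` — the leaf's «exactly one gauge transformation u»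

statement-level skeleton of published theorems with citation tags; proofs where landed; nothing here is a claim about the
Yang–Mills mass gap

PDF held: `paper:balaban1985-cmp99-regular-spaces-gauge-fixing` (journal page = PDF page + 74); pp. 78 ((1.17)), 80–82, 88–89, 94–95.

WHY THIS FILE (cell `pub-ymgap`, seat `pub-ymgap-dag-n05-a` g4, KNIT seat of DAG node N05 = [B8]; hazard №3 of the knit, B8-PIN-DESIGN-g2 §9).
The abstract leaf `B8.Thm4Body` concludes «`u′ = u`» IN THE TYPE `GT` of gauge transformations.  On the `ℤᵈ` carriers a gauge
transformation is a function on all sites, while every hypothesis and conclusion of Theorem 4 constrains it only on `Ω₀ = ⋃_j ⋃_{y ∈ Λ_j}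
Bʲ(y)` (the constraint structure partitions `Ω₀`, p. 81); print's functions live on `Ω₀` and (1.17) reads `u` at both ends of the bonds
leaving `Ω₀`, i.e. `u = 1` off `Ω₀`.  So the `GT` of a family of record on these carriers is `{u // u = 1 off Ω₀}`, and the induction
must PRODUCE such a `u`: it does as soon as every Proposition-5 step delivers `v = e^{iλ} = 1` off `Ω₀` (`λ` a function on `Ω₀` extended by
zero — print's setting), since `u_{m+1} = u_m·v` and `u_0 = 1`.  This file re-runs the g3 driver `B8Thm4InductionLocal.thm4_exists_all_levels`
with that invariant (the step `B8Thm4ExistsLocal.thm4_exists_step_onBonds` re-proved with the witness `u = u₁v` exposed, from the public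
`bond_1110_local` + `B8Thm4TruncationLocal.base_datum`), composes it with n04-b's `hP3_gaugeFixed_of_b9` and `H42_of_inAx` exactly as
`B8Thm4ExistsModB9` does, instantiates `Lan := IsLandau138W`, and turns the tower-agreement of `B8Thm4AtLandau138.thm4_unique_leafShape_landau138`
into the EQUALITY `u₁ = u₂` under the partition clause «Ω₀ ⊂ ⋃ towers» and the support clause — the `Thm4Body` shape of both clauses.

WHAT THIS FILE PROVES (kernel, 0 sorry, theorems only): `thm4_exists_step_onBonds_supp` (the step with support), **`thm4_exists_all_levels_supp`**
(the driver with `∀ x ∉ S, u x = 1`; sockets `hP5base`/`hP5` deliver and may assume the support clause),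
**`thm4_exists_all_levels_supp_landau138`** (hP3 := Prop. 3 for gauge-fixed fields, H42 := the (1.42) clause from the axial gauge, `Lan :=
IsLandau138W` — remaining: Prop. 5 sockets, `H59` (b9), standing hypotheses, windows), **`thm4_unique_eq_landau138`** (`u₁ = u₂`).

HONEST SCOPE.  Bookkeeping re-runs and compositions BY NAME; Propositions 3/5, (1.42), (1.59) are not re-proved; count-neutral; N05 NOT
discharged; nothing continuum / ℝ⁴ / OS / mass-gap / Clay.  Unit `pub-ymgap-dag-n05-a` (g4), 2026-08-26.
-/

noncomputable section

open NormedSpace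

namespace Literature.MathematicalPhysics.QuantumFieldTheory.Balaban1983to89.B8Thm4SupportLocal

open Complex (I)
open MatrixLog B7Prop1Explicit B7Prop2Explicit B7Prop1Local B7Eq92Concrete
open B8Ineq132 (covDerivFwd InAk)
open B8Eq119TwistedAxial (Restr129 InAx)
open B8Eq184Proof (gaugeExp cfgExp)
open B8Thm4ExistsLocal (bond_1110_local)
open B8Thm4TruncationLocal (base_datum restr129_one)
open B8Prop3GaugeFixedKLevel (hP3_gaugeFixed_of_b9 mem_unitaryUnits_of_mgauge_eq)
open B8Lemma1NonAbelian (mulCfg)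
open B8Eq140Level (SideTouches)
open B8Eq146AExpansion (iEta)
open B7Prop4GeneralLevels (logCovIter linCovIter)
open B8Eq155JBound (Jcur wsup)
open B8ScaledSupNorm (bondNorm msup)
open B7Prop3Flat (c3)
open B8Thm2LogB (blockTop)
open B8Ineq130 (tlo thi)
open B8Eq138LandauZd (IsLandau138W)
open B8Thm4AtLandau138 (thm4_unique_leafShape_landau138)

-- `Site` alone could resolve to the torus sites of `Setup.lean`; re-export the `ℤ^d` sites of `B7Prop1Explicit`.
export B7Prop1Explicit (Site)

variable {d : ℕ}

section Step

variable {𝔸 : Type*} [CStarAlgebra 𝔸] [Nontrivial 𝔸]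
variable {L k : ℕ} {η : ℝ} {Λ : ℕ → Set (Site d)} {U₀ U' U₁ : Site d → Fin d → 𝔸ˣ} {u₁ v : Site d → 𝔸ˣ}
  {A : Site d → Fin d → 𝔸} {lam : Site d → 𝔸} {c α₄ : ℝ}

/-- **THE INDUCTION STEP WITH THE SUPPORT INVARIANT** — `B8Thm4ExistsLocal.thm4_exists_step_onBonds` with the witness `u = u₁·v` EXPOSED:
if `u₁ = 1` and `v = 1` off `S` then the new gauge transformation is `1` off `S`.  (Re-proved from the public `bond_1110_local` and
`B8Thm4TruncationLocal.base_datum`; statement otherwise verbatim.) [cite: Balaban1985RegularSpaces, Thm 4 p.88, (1.110)–(1.111) p.95, (1.17) p.78] -/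
theorem thm4_exists_step_onBonds_supp (hL1 : 1 ≤ L) (hη : 0 < η)
    (hU₀ : ∀ x κ, U₀ x κ ∈ unitaryUnits 𝔸) (hU' : ∀ x κ, U' x κ ∈ unitaryUnits 𝔸)
    (hu₁ : ∀ x, u₁ x ∈ unitaryUnits 𝔸) (hv : ∀ x, v x ∈ unitaryUnits 𝔸)
    (S : Set (Site d)) (hu₁S : ∀ x, x ∉ S → u₁ x = 1) (hvS : ∀ x, x ∉ S → v x = 1)
    (hc : 0 ≤ c) (hα₄ : 0 ≤ α₄) (hs₁ : α₄ ≤ 1 / 84) (hs₂ : c ≤ 1 / 12)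
    (h₁ : mgauge U₀ u₁ U₁ = U') (E : ℕ → Set (Site d × Fin d))
    (hA : ∀ j, j ≤ k → ∀ b ∈ E j, U₁ b.1 b.2 = cfgExp η A b.1 b.2)
    (h69 : ∀ j, j ≤ k → ∀ b ∈ E j, ‖A b.1 b.2‖ ≤ c * ((L : ℝ) ^ j * η)⁻¹)
    (hvlam : ∀ j, j ≤ k → ∀ b ∈ E j,
      (v b.1 : 𝔸) = ((gaugeExp lam b.1 : 𝔸ˣ) : 𝔸) ∧ (v (b.1 + e b.2) : 𝔸) = ((gaugeExp lam (b.1 + e b.2) : 𝔸ˣ) : 𝔸))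
    (h108 : ∀ j, j ≤ k → ∀ b ∈ E j, ‖lam b.1‖ ≤ α₄ ∧ ((L : ℝ) ^ j * η) * ‖covDerivFwd η U₀ b.2 lam b.1‖ ≤ α₄)
    (Lan : (Site d → Fin d → 𝔸ˣ) → Prop) (hLan : Lan (mgauge U₀ v⁻¹ U₁)) (h129 : Restr129 L k Λ U₀ (u₁ * v)) :
    ∃ u : Site d → 𝔸ˣ, (∀ x, u x ∈ unitaryUnits 𝔸) ∧ (∀ x, x ∉ S → u x = 1) ∧ Restr129 L k Λ U₀ u ∧
      ∃ W : Site d → Fin d → 𝔸ˣ, mgauge U₀ u W = U' ∧ Lan W ∧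
        ∃ A' : Site d → Fin d → 𝔸, ∀ j, j ≤ k → ∀ b ∈ E j,
          W b.1 b.2 = cfgExp η A' b.1 b.2 ∧ IsSelfAdjoint (A' b.1 b.2) ∧ ‖A' b.1 b.2‖ ≤ (2 * c + 8 * α₄) * ((L : ℝ) ^ j * η)⁻¹ := by
  have hLr : (1 : ℝ) ≤ L := by exact_mod_cast hL1
  have hu : ∀ x, (u₁ * v) x ∈ unitaryUnits 𝔸 := fun x => by
    rw [Pi.mul_apply]; exact (unitaryUnits 𝔸).mul_mem (hu₁ x) (hv x)
  have hW : mgauge U₀ (u₁ * v) (mgauge U₀ v⁻¹ U₁) = U' := by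
    rw [B7Eq106Concrete.mgauge_mgauge, mul_assoc, mul_inv_cancel, mul_one, h₁]
  have hWu : ∀ x κ, mgauge U₀ v⁻¹ U₁ x κ ∈ unitaryUnits 𝔸 := mem_unitaryUnits_of_mgauge_eq hU₀ hU' hu hW
  refine ⟨u₁ * v, hu, fun x hx => ?_, h129, mgauge U₀ v⁻¹ U₁, hW, hLan,
    fun y μ => η⁻¹ • ((I⁻¹ : ℂ) • mlog ((mgauge U₀ v⁻¹ U₁ y μ : 𝔸ˣ) : 𝔸)), fun j hjk b hb => ?_⟩
  · rw [Pi.mul_apply, hu₁S x hx, hvS x hx, one_mul]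
  · have ht : 0 ≤ ((L : ℝ) ^ j * η)⁻¹ := by positivity
    have hpos : (0 : ℝ) < (L : ℝ) ^ j * η := by positivity
    have hηt : η * ((L : ℝ) ^ j * η)⁻¹ ≤ 1 := by
      have hLj : (1 : ℝ) ≤ (L : ℝ) ^ j := one_le_pow₀ hLr
      have e : η * ((L : ℝ) ^ j * η)⁻¹ = ((L : ℝ) ^ j)⁻¹ := by field_simp
      rw [e]
      exact inv_le_one_of_one_le₀ hLj
    obtain ⟨hl, hD'⟩ := h108 j hjk b hb
    have hD : ‖covDerivFwd η U₀ b.2 lam b.1‖ ≤ α₄ * ((L : ℝ) ^ j * η)⁻¹ := by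
      rw [← div_eq_mul_inv]
      exact (le_div_iff₀' hpos).2 hD'
    obtain ⟨hbd, hexp, hnear⟩ := bond_1110_local hη U₀ U₁ v A b.2 hc hα₄ ht hηt (hvlam j hjk b hb).1 (hvlam j hjk b hb).2
      (hA j hjk b hb) hl hD (h69 j hjk b hb) hs₁ hs₂
    obtain ⟨-, -, hsa, -⟩ := base_datum hη U₀ (mgauge U₀ v⁻¹ U₁) hWu (le_refl (1 / 4 : ℝ)) b.1 b.2 hnear
    exact ⟨hexp.symm, hsa, hbd⟩

end Step

section Main

variable {𝔸 : Type*} [CStarAlgebra 𝔸] [Nontrivial 𝔸]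
variable {L k : ℕ} {η : ℝ} {U₀ U' : Site d → Fin d → 𝔸ˣ} {a cstar α₄ : ℝ}

/-- One level up costs a factor `L`: `c⋆(Lʲη)⁻¹ = (Lc⋆)(L^{j+1}η)⁻¹` and `c⋆(Lʲη)⁻¹ ≤ (Lc⋆)(Lʲη)⁻¹` (`L ≥ 1`, `c⋆ ≥ 0`) — the bookkeeping of
(1.111) (`B8Eq1110Concrete.ineq1111_of_1110`). [cite: Balaban1985RegularSpaces, (1.111) p.95] -/
private theorem level_shift (hL1 : 1 ≤ L) (hη : 0 < η) (hc : 0 ≤ cstar) (j : ℕ) :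
    cstar * ((L : ℝ) ^ j * η)⁻¹ = L * cstar * ((L : ℝ) ^ (j + 1) * η)⁻¹ ∧
      cstar * ((L : ℝ) ^ j * η)⁻¹ ≤ L * cstar * ((L : ℝ) ^ j * η)⁻¹ := by
  have hLr : (1 : ℝ) ≤ L := by exact_mod_cast hL1
  have hL0 : (0 : ℝ) < L := by linarith
  have ht : 0 ≤ ((L : ℝ) ^ j * η)⁻¹ := by positivity
  refine ⟨?_, ?_⟩
  · rw [pow_succ]
    field_simp
  · calc cstar * ((L : ℝ) ^ j * η)⁻¹ = 1 * cstar * ((L : ℝ) ^ j * η)⁻¹ := by ring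
      _ ≤ L * cstar * ((L : ℝ) ^ j * η)⁻¹ := by gcongr

/-- **THE INDUCTION DRIVER WITH THE SUPPORT INVARIANT** — `B8Thm4InductionLocal.thm4_exists_all_levels` re-run: the Proposition-5 sockets
`hP5base`/`hP5` also deliver `v = 1` off `S` (and `hP5` may assume `u₁ = 1` off `S`), and the produced `u` is `1` off `S` at every level
(`u_0 = 1`, `u_{m+1} = u_m·v`).  Everything else verbatim (see the g3 driver's docstring: sockets, reset by Prop. 3, base datum).
[cite: Balaban1985RegularSpaces, Thm 4 p.88, proof pp.88–89 + 94–95, Prop. 5 (1.107)–(1.108) p.94, Prop. 3 p.87, (1.17) p.78] -/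
theorem thm4_exists_all_levels_supp (hL1 : 1 ≤ L) (hη : 0 < η) (S : Set (Site d))
    (hU₀ : ∀ x κ, U₀ x κ ∈ unitaryUnits 𝔸) (hU' : ∀ x κ, U' x κ ∈ unitaryUnits 𝔸)
    (hcstar : 0 ≤ cstar) (hα₄ : 0 ≤ α₄) (hs₁ : α₄ ≤ 1 / 84) (hs₂ : L * cstar ≤ 1 / 12) (ha : a ≤ 1 / 4) (ha2 : 2 * a ≤ cstar)
    (E : ℕ → Set (Site d × Fin d)) (hE : ∀ j, E (j + 1) ⊆ E j)
    (h66 : ∀ b ∈ E 0, ‖((U' b.1 b.2 : 𝔸ˣ) : 𝔸) - 1‖ ≤ a)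
    (Λs : ℕ → ℕ → Set (Site d)) (Lan : ℕ → (Site d → Fin d → 𝔸ˣ) → Prop)
    (hP5base : ∃ (v : Site d → 𝔸ˣ) (lam : Site d → 𝔸), (∀ x, v x ∈ unitaryUnits 𝔸) ∧ (∀ x, x ∉ S → v x = 1) ∧
        (∀ j, j ≤ 1 → ∀ b ∈ E j, (v b.1 : 𝔸) = ((gaugeExp lam b.1 : 𝔸ˣ) : 𝔸) ∧
          (v (b.1 + e b.2) : 𝔸) = ((gaugeExp lam (b.1 + e b.2) : 𝔸ˣ) : 𝔸)) ∧
        (∀ j, j ≤ 1 → ∀ b ∈ E j, ‖lam b.1‖ ≤ α₄ ∧ ((L : ℝ) ^ j * η) * ‖covDerivFwd η U₀ b.2 lam b.1‖ ≤ α₄) ∧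
        Lan 1 (mgauge U₀ v⁻¹ U') ∧ Restr129 L 1 (Λs 1) U₀ ((1 : Site d → 𝔸ˣ) * v))
    (hP5 : ∀ m, 1 ≤ m → m < k → ∀ (u₁ : Site d → 𝔸ˣ) (U₁ : Site d → Fin d → 𝔸ˣ) (A : Site d → Fin d → 𝔸),
      (∀ x, u₁ x ∈ unitaryUnits 𝔸) → (∀ x, x ∉ S → u₁ x = 1) → mgauge U₀ u₁ U₁ = U' → Restr129 L m (Λs m) U₀ u₁ → Lan m U₁ →
      (∀ j, j ≤ m → ∀ b ∈ E j, U₁ b.1 b.2 = cfgExp η A b.1 b.2 ∧ IsSelfAdjoint (A b.1 b.2) ∧ ‖A b.1 b.2‖ ≤ cstar * ((L : ℝ) ^ j * η)⁻¹) →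
      ∃ (v : Site d → 𝔸ˣ) (lam : Site d → 𝔸), (∀ x, v x ∈ unitaryUnits 𝔸) ∧ (∀ x, x ∉ S → v x = 1) ∧
        (∀ j, j ≤ m + 1 → ∀ b ∈ E j, (v b.1 : 𝔸) = ((gaugeExp lam b.1 : 𝔸ˣ) : 𝔸) ∧
          (v (b.1 + e b.2) : 𝔸) = ((gaugeExp lam (b.1 + e b.2) : 𝔸ˣ) : 𝔸)) ∧
        (∀ j, j ≤ m + 1 → ∀ b ∈ E j, ‖lam b.1‖ ≤ α₄ ∧ ((L : ℝ) ^ j * η) * ‖covDerivFwd η U₀ b.2 lam b.1‖ ≤ α₄) ∧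
        Lan (m + 1) (mgauge U₀ v⁻¹ U₁) ∧ Restr129 L (m + 1) (Λs (m + 1)) U₀ (u₁ * v))
    (hP3 : ∀ m, 1 ≤ m → m ≤ k → ∀ (u : Site d → 𝔸ˣ) (W : Site d → Fin d → 𝔸ˣ) (A : Site d → Fin d → 𝔸),
      (∀ x, u x ∈ unitaryUnits 𝔸) → mgauge U₀ u W = U' → Restr129 L m (Λs m) U₀ u → Lan m W →
      (∀ j, j ≤ m → ∀ b ∈ E j, W b.1 b.2 = cfgExp η A b.1 b.2 ∧ ‖A b.1 b.2‖ ≤ (2 * (L * cstar) + 8 * α₄) * ((L : ℝ) ^ j * η)⁻¹) →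
      ∀ j, j ≤ m → ∀ b ∈ E j, ‖A b.1 b.2‖ ≤ cstar * ((L : ℝ) ^ j * η)⁻¹) :
    ∀ m, m ≤ k → ∃ u : Site d → 𝔸ˣ, (∀ x, u x ∈ unitaryUnits 𝔸) ∧ (∀ x, x ∉ S → u x = 1) ∧ Restr129 L m (Λs m) U₀ u ∧
      ∃ W : Site d → Fin d → 𝔸ˣ, mgauge U₀ u W = U' ∧ (1 ≤ m → Lan m W) ∧
        ∃ A : Site d → Fin d → 𝔸, ∀ j, j ≤ m → ∀ b ∈ E j,
          W b.1 b.2 = cfgExp η A b.1 b.2 ∧ IsSelfAdjoint (A b.1 b.2) ∧ ‖A b.1 b.2‖ ≤ cstar * ((L : ℝ) ^ j * η)⁻¹ := by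
  have hLc : 0 ≤ L * cstar := by positivity
  -- reading a `c⋆`-bound at levels `≤ m` as an `Lc⋆`-bound at levels `≤ m + 1` (`E` antitone)
  have hshift : ∀ (m : ℕ) (A : Site d → Fin d → 𝔸),
      (∀ j, j ≤ m → ∀ b ∈ E j, ‖A b.1 b.2‖ ≤ cstar * ((L : ℝ) ^ j * η)⁻¹) →
      ∀ j, j ≤ m + 1 → ∀ b ∈ E j, ‖A b.1 b.2‖ ≤ L * cstar * ((L : ℝ) ^ j * η)⁻¹ := by
    intro m A h j hj b hb
    rcases Nat.lt_or_ge j (m + 1) with hjm | hjm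
    · exact (h j (by omega) b hb).trans (level_shift hL1 hη hcstar j).2
    · obtain rfl : j = m + 1 := le_antisymm hj hjm
      have h' := h m le_rfl b (hE m hb)
      rw [(level_shift hL1 hη hcstar m).1] at h'
      exact h'
  -- THE COMMON TAIL OF A STEP: level-`m` datum + Proposition 5's data at level `m + 1` ⇒ the conclusion at level `m + 1`
  -- (`thm4_exists_step_onBonds` with `c := Lc⋆`, then the reset `hP3 (m + 1)`)
  have tail : ∀ m, m < k → ∀ (u₁ : Site d → 𝔸ˣ) (U₁ : Site d → Fin d → 𝔸ˣ) (A : Site d → Fin d → 𝔸),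
      (∀ x, u₁ x ∈ unitaryUnits 𝔸) → (∀ x, x ∉ S → u₁ x = 1) → mgauge U₀ u₁ U₁ = U' →
      (∀ j, j ≤ m → ∀ b ∈ E j, U₁ b.1 b.2 = cfgExp η A b.1 b.2 ∧ IsSelfAdjoint (A b.1 b.2) ∧
        ‖A b.1 b.2‖ ≤ cstar * ((L : ℝ) ^ j * η)⁻¹) →
      ∀ (v : Site d → 𝔸ˣ) (lam : Site d → 𝔸), (∀ x, v x ∈ unitaryUnits 𝔸) → (∀ x, x ∉ S → v x = 1) →
        (∀ j, j ≤ m + 1 → ∀ b ∈ E j, (v b.1 : 𝔸) = ((gaugeExp lam b.1 : 𝔸ˣ) : 𝔸) ∧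
          (v (b.1 + e b.2) : 𝔸) = ((gaugeExp lam (b.1 + e b.2) : 𝔸ˣ) : 𝔸)) →
        (∀ j, j ≤ m + 1 → ∀ b ∈ E j, ‖lam b.1‖ ≤ α₄ ∧ ((L : ℝ) ^ j * η) * ‖covDerivFwd η U₀ b.2 lam b.1‖ ≤ α₄) →
        Lan (m + 1) (mgauge U₀ v⁻¹ U₁) → Restr129 L (m + 1) (Λs (m + 1)) U₀ (u₁ * v) →
      ∃ u : Site d → 𝔸ˣ, (∀ x, u x ∈ unitaryUnits 𝔸) ∧ (∀ x, x ∉ S → u x = 1) ∧ Restr129 L (m + 1) (Λs (m + 1)) U₀ u ∧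
        ∃ W : Site d → Fin d → 𝔸ˣ, mgauge U₀ u W = U' ∧ (1 ≤ m + 1 → Lan (m + 1) W) ∧
          ∃ A' : Site d → Fin d → 𝔸, ∀ j, j ≤ m + 1 → ∀ b ∈ E j,
            W b.1 b.2 = cfgExp η A' b.1 b.2 ∧ IsSelfAdjoint (A' b.1 b.2) ∧ ‖A' b.1 b.2‖ ≤ cstar * ((L : ℝ) ^ j * η)⁻¹ := by
    intro m hmk u₁ U₁ A hu₁ hu₁S hU₁ hA v lam hv hvS hvlam h108 hLan h129
    -- `U₁ = e^{iηA}` and (1.69) with `c = Lc⋆` on `E j`, `j ≤ m + 1`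
    have hAexp : ∀ j, j ≤ m + 1 → ∀ b ∈ E j, U₁ b.1 b.2 = cfgExp η A b.1 b.2 := by
      intro j hj b hb
      rcases Nat.lt_or_ge j (m + 1) with hjm | hjm
      · exact (hA j (by omega) b hb).1
      · obtain rfl : j = m + 1 := le_antisymm hj hjm
        exact (hA m le_rfl b (hE m hb)).1
    have h69 := hshift m A (fun j hj b hb => (hA j hj b hb).2.2)
    obtain ⟨u, hu, huS, h29, W, hW, hLanW, A', hA'⟩ := thm4_exists_step_onBonds_supp (k := m + 1) (Λ := Λs (m + 1)) hL1 hη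
      hU₀ hU' hu₁ hv S hu₁S hvS hLc hα₄ hs₁ hs₂ hU₁ E hAexp h69 hvlam h108 (Lan (m + 1)) hLan h129
    -- Proposition 3 at level `m + 1`: reset the constant `2Lc⋆ + 8α₄ ↦ c⋆`
    have hreset := hP3 (m + 1) (by omega) (by omega) u W A' hu hW h29 hLanW
      (fun j hj b hb => ⟨(hA' j hj b hb).1, (hA' j hj b hb).2.2⟩)
    exact ⟨u, hu, huS, h29, W, hW, fun _ => hLanW, A', fun j hj b hb => ⟨(hA' j hj b hb).1, (hA' j hj b hb).2.1, hreset j hj b hb⟩⟩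
  -- THE BASE DATUM: `u = 1`, `W = U′`, `A₀ = (1/iη) log U′`
  have base : ∀ j, j ≤ 0 → ∀ b ∈ E j,
      U' b.1 b.2 = cfgExp η (fun y μ => η⁻¹ • ((I⁻¹ : ℂ) • mlog ((U' y μ : 𝔸ˣ) : 𝔸))) b.1 b.2 ∧
        IsSelfAdjoint ((fun y μ => η⁻¹ • ((I⁻¹ : ℂ) • mlog ((U' y μ : 𝔸ˣ) : 𝔸))) b.1 b.2) ∧
        ‖(fun y μ => η⁻¹ • ((I⁻¹ : ℂ) • mlog ((U' y μ : 𝔸ˣ) : 𝔸))) b.1 b.2‖ ≤ cstar * ((L : ℝ) ^ j * η)⁻¹ := by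
    intro j hj b hb
    obtain rfl : j = 0 := Nat.le_zero.mp hj
    obtain ⟨-, hexp, hsa, hbd⟩ := base_datum hη U₀ U' hU' ha b.1 b.2 (h66 b hb)
    refine ⟨hexp, hsa, hbd.trans ?_⟩
    rw [pow_zero, one_mul]
    exact mul_le_mul_of_nonneg_right ha2 (inv_nonneg.mpr hη.le)
  have hone : mgauge U₀ (1 : Site d → 𝔸ˣ) U' = U' := by
    funext z μ; simp [mgauge_apply]
  intro m
  induction m with
  | zero =>
    intro _
    exact ⟨1, fun x => (unitaryUnits 𝔸).one_mem, fun _ _ => rfl, restr129_one L 0 (Λs 0) U₀, U', hone, fun h => absurd h (by omega),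
      _, base⟩
  | succ m ih =>
    intro hmk
    rcases Nat.eq_zero_or_pos m with rfl | hm
    · -- the first step («k = 1»): Proposition 5 for the base datum
      obtain ⟨v, lam, hv, hvS, hvlam, h108, hLan, h129⟩ := hP5base
      exact tail 0 (by omega) 1 U' _ (fun x => (unitaryUnits 𝔸).one_mem) (fun _ _ => rfl) hone base v lam hv hvS hvlam h108 hLan h129
    · -- the general step: Proposition 5 for the datum delivered at level `m`
      obtain ⟨u₁, hu₁, hu₁S, h129₁, U₁, hU₁, hLan₁, A, hA⟩ := ih (by omega)
      obtain ⟨v, lam, hv, hvS, hvlam, h108, hLan, h129⟩ := hP5 m hm (by omega) u₁ U₁ A hu₁ hu₁S hU₁ h129₁ (hLan₁ hm) hA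
      exact tail m (by omega) u₁ U₁ A hu₁ hu₁S hU₁ hA v lam hv hvS hvlam h108 hLan h129

end Main

section Composition

variable {𝔸 : Type*} [CStarAlgebra 𝔸] [Nontrivial 𝔸]

/-- **THEOREM 4, EXISTENCE CLAUSE AT ALL LEVELS, GAUGE TRANSFORMATIONS CARRIED BY Ω₀, LANDAU EQUATION INSTANTIATED, (1.42)
DISCHARGED** — `thm4_exists_all_levels_supp` at `E j :=` the bonds of `Ω_j` (`SideTouches`), `S := Ω 0`, `Lan m W := IsLandau138W L m η (Ω 0)
(Λs m) U₀ W`, with its socket `hP3` served by `B8Prop3GaugeFixedKLevel.hP3_gaugeFixed_of_b9` (Prop. 3 for gauge-fixed fields, modulo `H59` =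
[4] Thm 3.3) whose (1.42) clause is `B8Eq142KLevelLocal.H42_of_inAx` — the composition of `B8Thm4ExistsModB9` re-run on the support driver.
CONCLUSION: for every `m ≤ k` a unitary-valued `u` with `u = 1` off `Ω₀`, (1.29) at `m` levels, `U′^{u⁻¹}` in the (1.38) gauge with the (1.62)
shape on the bonds of `Ω_j`, `j ≤ m`.  REMAINING HYPOTHESES: Prop. 5 sockets (with the support clause), `H59` (b9), (1.33)/(1.34)/(1.34)-axial/
(1.35)/(1.66)₀, the family's geometry `hbox`/`hclass`, Ω antitone, explicit windows (`B8Thm4Windows.thm4_windows` + `dLα₁ ≤ 1/8`).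
[cite: Balaban1985RegularSpaces, Thm 4 p.88, (1.38) p.82, (1.42) p.83, Prop. 3 p.87, Prop. 5 p.94, pp.94–95, (1.17) p.78] -/
theorem thm4_exists_all_levels_supp_landau138 (hd2 : 2 ≤ d) {η : ℝ} (hη : 0 < η) {L : ℕ} (hL : 2 ≤ L) (k : ℕ)
    {U₀ U' : Site d → Fin d → 𝔸ˣ} (hU₀ : ∀ x κ, U₀ x κ ∈ unitaryUnits 𝔸) (hU' : ∀ x κ, U' x κ ∈ unitaryUnits 𝔸)
    {α₀ α₁ α₄ B₀ cstar a : ℝ} (hα₀ : 0 < α₀) (hα₁ : 0 < α₁) (hα₄ : 0 ≤ α₄) (hB₀ : 0 ≤ B₀)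
    (hc : cstar = 5 * d * L * B₀ * (α₀ + α₁))
    (hs₁ : α₄ ≤ 1 / 84) (hs₂ : L * cstar ≤ 1 / 12) (ha : a ≤ 1 / 4) (ha2 : 2 * a ≤ cstar)
    (hα3 : C0 d * α₀ ≤ 1 / 3) (hα4 : 4 * α₀ ≤ c2' d L)
    (h16 : 16 * (2 * (L * cstar) + 8 * α₄) ≤ 1) (hd5 : 5 * (2 * (L * cstar) + 8 * α₄) * ((d : ℝ) - 1) ≤ 4)
    (hsmall : Real.exp (4 * (800 * ((d : ℝ) + 1) ^ 2 * ((d : ℝ) + 4)) * α₀)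
      * (1 + 8 * (131072 * ((d : ℝ) + 1) ^ 2) * (2 * (L * cstar) + 8 * α₄)) ≤ 2)
    (hc₃ : 2 * (2 * (L * cstar) + 8 * α₄) ≤ c3 d L) (hside : 36 * d * B₀ * (2 * (L * cstar) + 8 * α₄) ≤ 1 / 2)
    (h50 : 50 * d * (2 * (L * cstar) + 8 * α₄) ≤ 1) (hsmall₁ : (d : ℝ) * L * α₁ ≤ 1 / 8)
    {C₂ : ℝ} (hC₂ : 8 * (131072 * ((d : ℝ) + 1) ^ 2) * Real.exp (4 * (800 * ((d : ℝ) + 1) ^ 2 * ((d : ℝ) + 4)) * α₀) ≤ C₂)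
    (h61 : 2 * (2 * (L * cstar) + 8 * α₄) ^ 2 + 20 * d * α₀ * (2 * (L * cstar) + 8 * α₄)
      + 2 * C₂ * (2 * (L * cstar) + 8 * α₄) ^ 2 ≤ α₀ + α₁)
    (Ω : ℕ → Set (Site d)) (hΩ : ∀ j, Ω (j + 1) ⊆ Ω j) (Λs : ℕ → ℕ → Set (Site d)) (Λb : ℕ → ℕ → Set (Site d × Fin d))
    (hbox : ∀ m, m ≤ k → ∀ j, j ≤ m → ∀ c ∈ Λb m j, ∀ x, InBox (loK L j c.1) (bondHiK L j c.1 c.2) x → x ∈ Ω j)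
    (hclass : ∀ m, m ≤ k → ∀ j, j ≤ m → ∀ c ∈ Λb m j,
      (c.1 ∈ Λs m j ∧ c.1 + e c.2 ∈ Λs m j) ∨
      (∃ j', j = j' + 1 ∧ (∀ x, (L : ℤ) • c.1 ≤ x → x ≤ (L : ℤ) • c.1 + blockTop L → x ∈ Λs m j') ∧ c.1 + e c.2 ∈ Λs m j) ∨
      (∃ j', j = j' + 1 ∧ c.1 ∈ Λs m j ∧ (∀ x, (L : ℤ) • (c.1 + e c.2) ≤ x → x ≤ (L : ℤ) • (c.1 + e c.2) + blockTop L → x ∈ Λs m j')))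
    (h33 : InAk L k η α₀ Ω U₀) (h34 : InAk L k η α₀ Ω (mulCfg U' U₀))
    (hAx : ∀ m, m ≤ k → InAx L m (Λs m) U₀ (mulCfg U' U₀))
    (h135 : ∀ j, j ≤ k → ∀ (z : Site d) (μ : Fin d), (∀ x, InBox (loK L j z) (bondHiK L j z μ) x → x ∈ Ω j) →
      ‖(avgIter L (mulCfg U' U₀) j z μ : 𝔸) - (avgIter L U₀ j z μ : 𝔸)‖ ≤ α₁)
    (h66 : ∀ b ∈ {b : Site d × Fin d | SideTouches (Ω 0) b.1 b.2}, ‖((U' b.1 b.2 : 𝔸ˣ) : 𝔸) - 1‖ ≤ a)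
    (hP5base : ∃ (v : Site d → 𝔸ˣ) (lam : Site d → 𝔸), (∀ x, v x ∈ unitaryUnits 𝔸) ∧ (∀ x, x ∉ Ω 0 → v x = 1) ∧
        (∀ j, j ≤ 1 → ∀ b ∈ {b : Site d × Fin d | SideTouches (Ω j) b.1 b.2}, (v b.1 : 𝔸) = ((gaugeExp lam b.1 : 𝔸ˣ) : 𝔸) ∧
          (v (b.1 + e b.2) : 𝔸) = ((gaugeExp lam (b.1 + e b.2) : 𝔸ˣ) : 𝔸)) ∧
        (∀ j, j ≤ 1 → ∀ b ∈ {b : Site d × Fin d | SideTouches (Ω j) b.1 b.2},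
          ‖lam b.1‖ ≤ α₄ ∧ ((L : ℝ) ^ j * η) * ‖covDerivFwd η U₀ b.2 lam b.1‖ ≤ α₄) ∧
        IsLandau138W L 1 η (Ω 0) (Λs 1) U₀ (mgauge U₀ v⁻¹ U') ∧ Restr129 L 1 (Λs 1) U₀ ((1 : Site d → 𝔸ˣ) * v))
    (hP5 : ∀ m, 1 ≤ m → m < k → ∀ (u₁ : Site d → 𝔸ˣ) (U₁ : Site d → Fin d → 𝔸ˣ) (A : Site d → Fin d → 𝔸),
      (∀ x, u₁ x ∈ unitaryUnits 𝔸) → (∀ x, x ∉ Ω 0 → u₁ x = 1) → mgauge U₀ u₁ U₁ = U' → Restr129 L m (Λs m) U₀ u₁ →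
      IsLandau138W L m η (Ω 0) (Λs m) U₀ U₁ →
      (∀ j, j ≤ m → ∀ b ∈ {b : Site d × Fin d | SideTouches (Ω j) b.1 b.2},
        U₁ b.1 b.2 = cfgExp η A b.1 b.2 ∧ IsSelfAdjoint (A b.1 b.2) ∧ ‖A b.1 b.2‖ ≤ cstar * ((L : ℝ) ^ j * η)⁻¹) →
      ∃ (v : Site d → 𝔸ˣ) (lam : Site d → 𝔸), (∀ x, v x ∈ unitaryUnits 𝔸) ∧ (∀ x, x ∉ Ω 0 → v x = 1) ∧
        (∀ j, j ≤ m + 1 → ∀ b ∈ {b : Site d × Fin d | SideTouches (Ω j) b.1 b.2}, (v b.1 : 𝔸) = ((gaugeExp lam b.1 : 𝔸ˣ) : 𝔸) ∧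
          (v (b.1 + e b.2) : 𝔸) = ((gaugeExp lam (b.1 + e b.2) : 𝔸ˣ) : 𝔸)) ∧
        (∀ j, j ≤ m + 1 → ∀ b ∈ {b : Site d × Fin d | SideTouches (Ω j) b.1 b.2},
          ‖lam b.1‖ ≤ α₄ ∧ ((L : ℝ) ^ j * η) * ‖covDerivFwd η U₀ b.2 lam b.1‖ ≤ α₄) ∧
        IsLandau138W L (m + 1) η (Ω 0) (Λs (m + 1)) U₀ (mgauge U₀ v⁻¹ U₁) ∧ Restr129 L (m + 1) (Λs (m + 1)) U₀ (u₁ * v))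
    (H59 : ∀ m, 1 ≤ m → m ≤ k → ∀ (u : Site d → 𝔸ˣ) (W : Site d → Fin d → 𝔸ˣ) (A' : Site d → Fin d → 𝔸),
      (∀ x, u x ∈ unitaryUnits 𝔸) → mgauge U₀ u W = U' → Restr129 L m (Λs m) U₀ u → IsLandau138W L m η (Ω 0) (Λs m) U₀ W →
      (∀ y τ, IsSelfAdjoint (A' y τ)) →
      (∀ j, j ≤ m → ∀ y τ, SideTouches (Ω j) y τ →
        W y τ = cfgExp η A' y τ ∧ ‖A' y τ‖ ≤ (2 * (L * cstar) + 8 * α₄) * ((L : ℝ) ^ j * η)⁻¹) →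
      (∀ y τ, (∀ j, j ≤ m → ¬ SideTouches (Ω j) y τ) → A' y τ = 0) →
      msup L m η (-(1 : ℝ)) (fun j (b : Site d × Fin d) => SideTouches (Ω j) b.1 b.2) (fun b => A' b.1 b.2)
          ≤ B₀ * (bondNorm L m η (-(3 : ℝ)) Ω (fun x μ => Jcur η U₀ A' μ x)
            + wsup 1 (fun p : {p : ℕ × (Site d × Fin d) // p.1 ≤ m ∧ p.2 ∈ Λb m p.1} =>
                linCovIter L U₀ (iEta η A') p.1.1 p.1.2.1 p.1.2.2)) ∧
        msup L m η (-(2 : ℝ)) (fun j (t : Fin d × Fin d × Site d) => SideTouches (Ω j) t.2.2 t.2.1)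
            (fun t => covDerivFwd η U₀ t.1 (fun z => A' z t.2.1) t.2.2)
          ≤ B₀ * (bondNorm L m η (-(3 : ℝ)) Ω (fun x μ => Jcur η U₀ A' μ x)
            + wsup 1 (fun p : {p : ℕ × (Site d × Fin d) // p.1 ≤ m ∧ p.2 ∈ Λb m p.1} =>
                linCovIter L U₀ (iEta η A') p.1.1 p.1.2.1 p.1.2.2))) :
    ∀ m, m ≤ k → ∃ u : Site d → 𝔸ˣ, (∀ x, u x ∈ unitaryUnits 𝔸) ∧ (∀ x, x ∉ Ω 0 → u x = 1) ∧ Restr129 L m (Λs m) U₀ u ∧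
      ∃ W : Site d → Fin d → 𝔸ˣ, mgauge U₀ u W = U' ∧ (1 ≤ m → IsLandau138W L m η (Ω 0) (Λs m) U₀ W) ∧
        ∃ A : Site d → Fin d → 𝔸, ∀ j, j ≤ m → ∀ b ∈ {b : Site d × Fin d | SideTouches (Ω j) b.1 b.2},
          W b.1 b.2 = cfgExp η A b.1 b.2 ∧ IsSelfAdjoint (A b.1 b.2) ∧ ‖A b.1 b.2‖ ≤ cstar * ((L : ℝ) ^ j * η)⁻¹ := by
  have hL1 : 1 ≤ L := le_trans (by norm_num) hL
  have hcstar : 0 ≤ cstar := by rw [hc]; positivity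
  have hα₂ : 0 ≤ 2 * (L * cstar) + 8 * α₄ := by positivity
  have hE : ∀ j, {b : Site d × Fin d | SideTouches (Ω (j + 1)) b.1 b.2} ⊆ {b : Site d × Fin d | SideTouches (Ω j) b.1 b.2} :=
    fun j b hb => B8Eq140Level.sideTouches_mono (hΩ j) hb
  exact thm4_exists_all_levels_supp hL1 hη (Ω 0) hU₀ hU' hcstar hα₄ hs₁ hs₂ ha ha2
    (fun j => {b : Site d × Fin d | SideTouches (Ω j) b.1 b.2}) hE h66 Λs (fun m W => IsLandau138W L m η (Ω 0) (Λs m) U₀ W)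
    hP5base hP5
    (hP3_gaugeFixed_of_b9 hd2 hη hL k hU₀ hU' hα₀ hα₁.le hα₄ hB₀ hc hα3 hα4 h16 hd5 hsmall hc₃ hside h50 hC₂ h61 Ω Λs Λb hbox
      h33 h34 (fun m W => IsLandau138W L m η (Ω 0) (Λs m) U₀ W)
      (B8Eq142KLevelLocal.H42_of_inAx hd2 hη hL k hU₀ hα₀ hα₁ hα₂ hα3 hα4 h16 hsmall hc₃ hsmall₁ Ω hΩ Λs Λb hbox hclass h33 h34
        hAx h135 (fun m W => IsLandau138W L m η (Ω 0) (Λs m) U₀ W))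
      H59)

end Composition

section UniqueEq

variable {𝔸 : Type*} [CStarAlgebra 𝔸] [Nontrivial 𝔸]
variable {L k : ℕ} {η : ℝ} {Ω : ℕ → Set (Site d)} {Λ : ℕ → Set (Site d)} {U₀ U' : Site d → Fin d → 𝔸ˣ} {α₀ αP c : ℝ}
  {u₁ u₂ : Site d → 𝔸ˣ}

/-- **THEOREM 4, UNIQUENESS CLAUSE AS AN EQUALITY `u₁ = u₂`** («there exists EXACTLY ONE gauge transformation u», p. 88) on the concrete
carriers with the gauge transformations CARRIED BY Ω₀: two unitary-valued `u₁`, `u₂`, both `= 1` off `Ω₀`, both with (1.29), whose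
`U′^{u_i⁻¹}` satisfy (1.38) `IsLandau138W` and the (1.62)-shape on the bonds of `Ω_j`, are EQUAL — from the tower agreement of
`B8Thm4AtLandau138.thm4_unique_leafShape_landau138` (modulo Prop. 5's uniqueness socket `hP5u`), the PARTITION CLAUSE of the constraint
structure «`Ω₀ ⊂ ⋃_{j ≤ k} ⋃_{y ∈ Λ_j} Bʲ(y)`» (p. 81, `hpart` — a datum of the family of record) and the support clause.  This is the
`∀ u′, … → u′ = u` conjunct of `B8.Thm4Body` at `GT := {u // u = 1 off Ω₀}`.
[cite: Balaban1985RegularSpaces, Thm 4 p.88 («exactly one»), (1.29) p.81, proof p.95 (1.112), Prop. 5 (1.109) p.94] -/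
theorem thm4_unique_eq_landau138 (hd2 : 2 ≤ d) (hL : 2 ≤ L) (hη : 0 < η)
    (hU₀ : ∀ x κ, U₀ x κ ∈ unitaryUnits 𝔸) (hU' : ∀ x κ, U' x κ ∈ unitaryUnits 𝔸)
    (hu₁ : ∀ x, u₁ x ∈ unitaryUnits 𝔸) (hu₂ : ∀ x, u₂ x ∈ unitaryUnits 𝔸)
    (hα : 0 < α₀) (hα3 : C0 d * α₀ ≤ 1 / 3) (hα4 : 4 * α₀ ≤ c2' d L) (hc : 0 ≤ c)
    (hsmall : Real.exp (4 * (800 * ((d : ℝ) + 1) ^ 2 * ((d : ℝ) + 4)) * α₀) * (1 + 8 * (131072 * ((d : ℝ) + 1) ^ 2) * c) ≤ 2)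
    (hc₃ : 2 * c ≤ c3 d L) (hsm : 2048 * (d : ℝ) * c ≤ 1) (hα₃ : 40 * d * c ≤ 1 / 5000)
    (hαP : 0 < αP) (hαP3 : C0 d * αP ≤ 1 / 3) (hαP2 : 2 * αP ≤ c2' d L)
    {cu : ℝ} (hcu₁ : 2 * (2 * (40 * d * c) + 2 * 1116 * (40 * d * c) ^ 2) < cu) (hcu₂ : 5 * c < cu)
    (h33 : InAk L k η α₀ Ω U₀) (h34 : InAk L k η αP Ω (U' * U₀)) (hAx : InAx L k Λ U₀ (U' * U₀))
    (htower : ∀ j, j ≤ k → ∀ y ∈ Λ j, ∀ x, InBox (tlo L y j) (thi L y j) x → x ∈ Ω j)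
    (h129₁ : Restr129 L k Λ U₀ u₁) (h129₂ : Restr129 L k Λ U₀ u₂)
    (hLan₁ : IsLandau138W L k η (Ω 0) Λ U₀ (mgauge U₀ u₁⁻¹ U')) (hLan₂ : IsLandau138W L k η (Ω 0) Λ U₀ (mgauge U₀ u₂⁻¹ U'))
    (h162₁ : ∃ A₁ : Site d → Fin d → 𝔸, ∀ j, j ≤ k → ∀ (x : Site d) (κ : Fin d), SideTouches (Ω j) x κ →
      mgauge U₀ u₁⁻¹ U' x κ = cfgExp η A₁ x κ ∧ ‖A₁ x κ‖ ≤ c * ((L : ℝ) ^ j * η)⁻¹)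
    (h162₂ : ∃ A₂ : Site d → Fin d → 𝔸, ∀ j, j ≤ k → ∀ (x : Site d) (κ : Fin d), SideTouches (Ω j) x κ →
      mgauge U₀ u₂⁻¹ U' x κ = cfgExp η A₂ x κ ∧ ‖A₂ x κ‖ ≤ c * ((L : ℝ) ^ j * η)⁻¹)
    (hP5u : ∀ (v w : Site d → 𝔸ˣ) (lam mu : Site d → 𝔸),
      (∀ j, j ≤ k → ∀ y ∈ Λ j, ∀ x : Site d, InBox (tlo L y j) (thi L y j) x →
        ((gaugeExp lam x : 𝔸ˣ) : 𝔸) = ((v x : 𝔸ˣ) : 𝔸) ∧ IsSelfAdjoint (lam x) ∧ ‖lam x‖ < cu ∧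
          ∀ κ : Fin d, InBox (tlo L y j) (thi L y j) (x + e κ) → ((L : ℝ) ^ j * η) * ‖covDerivFwd η U₀ κ lam x‖ < cu) →
      (∀ j, j ≤ k → ∀ y ∈ Λ j, ∀ x : Site d, InBox (tlo L y j) (thi L y j) x →
        ((gaugeExp mu x : 𝔸ˣ) : 𝔸) = ((w x : 𝔸ˣ) : 𝔸) ∧ IsSelfAdjoint (mu x) ∧ ‖mu x‖ < cu ∧
          ∀ κ : Fin d, InBox (tlo L y j) (thi L y j) (x + e κ) → ((L : ℝ) ^ j * η) * ‖covDerivFwd η U₀ κ mu x‖ < cu) →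
      IsLandau138W L k η (Ω 0) Λ U₀ (mgauge U₀ v⁻¹ (mgauge U₀ u₁⁻¹ U')) → Restr129 L k Λ U₀ (u₁ * v) →
      IsLandau138W L k η (Ω 0) Λ U₀ (mgauge U₀ w⁻¹ (mgauge U₀ u₁⁻¹ U')) → Restr129 L k Λ U₀ (u₁ * w) →
      ∀ j, j ≤ k → ∀ y ∈ Λ j, ∀ x : Site d, InBox (tlo L y j) (thi L y j) x → v x = w x)
    (hpart : ∀ x, x ∈ Ω 0 → ∃ j, j ≤ k ∧ ∃ y ∈ Λ j, InBox (tlo L y j) (thi L y j) x)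
    (hu₁S : ∀ x, x ∉ Ω 0 → u₁ x = 1) (hu₂S : ∀ x, x ∉ Ω 0 → u₂ x = 1) :
    u₁ = u₂ := by
  have htw := thm4_unique_leafShape_landau138 hd2 hL hη hU₀ hU' hu₁ hu₂ hα hα3 hα4 hc hsmall hc₃ hsm hα₃ hαP hαP3 hαP2 hcu₁ hcu₂ h33
    h34 hAx htower h129₁ h129₂ hLan₁ hLan₂ h162₁ h162₂ hP5u
  funext x
  by_cases hx : x ∈ Ω 0
  · obtain ⟨j, hj, y, hy, hxy⟩ := hpart x hx
    exact htw j hj y hy x hxy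
  · rw [hu₁S x hx, hu₂S x hx]

end UniqueEq

#print axioms thm4_exists_all_levels_supp
#print axioms thm4_unique_eq_landau138
#print axioms thm4_exists_all_levels_supp_landau138

end Literature.MathematicalPhysics.QuantumFieldTheory.Balaban1983to89.B8Thm4SupportLocal

end
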